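import Summits.SmoothPoincare4.SmoothPoincare4.Theorems.AcyclicBisectionExists.Negative.Sphere

/-!
# `PlanarBisectionExists` — support: the ∃-body over witnesses, doubles of planar Stein domains,
# transport, and the kill criterion `SmoothPoincare4 → PlanarBisectionExists`

Support lemmas for the item
`Summit.SmoothPoincare4.SmoothPoincare4.Theses.ConvexBisection.PlanarBisectionExists`
(stmt-SmoothPoincare4-10512, route ConvexBisection, support rank 9): *every smooth homotopy
4-sphere admits a Stein bisection along a common contact seam whose first half has PLANAR contact
boundary and whose seam is CONNECTED.*

* §1 `planarBisectionExists_iff` — the item unfolded over the sibling crux's `Witness`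
  (`Theorems/AcyclicBisectionExists/Negative/Witness.lean`): `PlanarBisectionExists ↔ ∀ M ≃ₕ S⁴,
  ∃ B : Witness M, PlanarContactBoundary B.J₁ ∧ IsConnected B.seam`;
  `steinBisectionExists_of_planarBisectionExists` (the item refines support item
  `SteinBisectionExists`, stmt-SmoothPoincare4-10509).
* §2 `seam_transport`, `exists_planar_connected_of_diffeomorph` — the ∃-body is a diffeomorphism
  invariant (planarity is a property of `J₁` alone; the seam moves by the diffeomorphism).
* §3 `exists_planar_connected_of_isDouble` — **every double `D(W) = W ∪_id W̄` of a compact Stein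
  domain with planar contact boundary and connected `∂W` satisfies the ∃-body** (the sibling's
  `steinBisection_of_isDouble` + the seam is the embedded copy of `∂W`): the formal content of the
  item text's "every planar Stein cork `C` gives the planar bisection `D(C)`".
* §4 `exists_planar_connected_sphere_of`, `planarBisectionExists_of_smoothPoincare4_of`,
  `not_smoothPoincare4_of_not_planarBisectionExists_of` — at `S⁴ = D(𝔻⁴)` (tree
  `isDouble_sphere_holds`) with the standard Stein ball on both hemispheres, MODULO the planarity of
  `(S³, ξ_std) = ∂(𝔻⁴, J₀, |z|²)` (`PlanarContactBoundary steinStructureClosedBall`, the disc open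
  book; proved in the standing disprover's work file of crux PlanarBisectionRigidity, not yet a
  Theorems module — taken here as the explicit hypothesis `hP`): the item is implied by the summit,
  so a refutation of it is an exotic 4-sphere.
* §5 `planarBisectionExists_false_without_homotopyEquiv` — the hypothesis `M ≃ₕ S⁴` is
  load-bearing (false at `M = ℝ⁴`: witnesses force compactness).
-/

noncomputable section

-- the prescribed namespace `Summit.<P>.<Sub>.…` duplicates `SmoothPoincare4` (P = Sub)
set_option linter.dupNamespace false

open scoped Manifold ContDiff Topology ContinuousMap
open Set Function
open Literature.Geometry.Symplectic Literature.Topology.FourManifolds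

namespace Summit.SmoothPoincare4.SmoothPoincare4.Theorems.PlanarBisectionExists

open Summit.SmoothPoincare4.SmoothPoincare4.Theses.ConvexBisection
open Summit.SmoothPoincare4.SmoothPoincare4.Theorems.AcyclicBisectionExists.Negative
open Summit.SmoothPoincare4.SmoothPoincare4.Theorems.ContractibleTwistedDoubleStandard.Negative

/-! ## §1 The item over witnesses; relation to `SteinBisectionExists` -/

/-- **The item, unfolded**: `PlanarBisectionExists ↔` every smooth `M ≃ₕ S⁴` carries a witness
(a Stein bisection along a common contact seam) whose first Stein structure has planar contact
boundary and whose seam is connected. [folklore] -/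
theorem planarBisectionExists_iff :
    PlanarBisectionExists ↔
      ∀ (M : Type) [TopologicalSpace M] [T2Space M] [SecondCountableTopology M]
        [ChartedSpace (EuclideanSpace ℝ (Fin 4)) M] [IsManifold (𝓡 4) ∞ M],
        M ≃ₕ (Metric.sphere (0 : EuclideanSpace ℝ (Fin 5)) 1) →
          ∃ B : Witness M, PlanarContactBoundary B.J₁ ∧ IsConnected B.seam := by
  constructor
  · intro h M _ _ _ _ _ f
    obtain ⟨W₁, _, _, _, _, W₂, _, _, _, _, J₁, J₂, e₁, e₂, h1, h2, h3, h4, h5, h6, h7, h8⟩ :=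
      h M f
    exact ⟨⟨W₁, W₂, J₁, J₂, e₁, e₂, h1, h2, h3, h4, h5, h6⟩, h7, h8⟩
  · intro h M _ _ _ _ _ f
    obtain ⟨B, hP, hC⟩ := h M f
    exact ⟨B.W₁, inferInstance, inferInstance, inferInstance, inferInstance, B.W₂, inferInstance,
      inferInstance, inferInstance, inferInstance, B.J₁, B.J₂, B.e₁, B.e₂, B.emb₁, B.emb₂, B.cover,
      B.inter₁, B.inter₂, B.contact, hP, hC⟩

/-- **The item refines `SteinBisectionExists`** (support item stmt-SmoothPoincare4-10509): forget
planarity and connectedness. [folklore] -/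
theorem steinBisectionExists_of_planarBisectionExists (h : PlanarBisectionExists) :
    SteinBisectionExists := by
  intro M _ _ _ _ _ f
  obtain ⟨B, -, -⟩ := planarBisectionExists_iff.1 h M f
  exact ⟨B.W₁, inferInstance, inferInstance, inferInstance, inferInstance, B.W₂, inferInstance,
    inferInstance, inferInstance, inferInstance, B.J₁, B.J₂, B.e₁, B.e₂, B.emb₁, B.emb₂, B.cover,
    B.inter₁, B.inter₂, B.contact⟩

/-! ## §2 Transport along diffeomorphisms -/

section Transport

variable {M N : Type} [TopologicalSpace M] [ChartedSpace (EuclideanSpace ℝ (Fin 4)) M]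
  [IsManifold (𝓡 4) ∞ M]
  [TopologicalSpace N] [ChartedSpace (EuclideanSpace ℝ (Fin 4)) N] [IsManifold (𝓡 4) ∞ N]

/-- The seam of a transported witness is the image of the seam. [folklore] -/
theorem seam_transport (B : Witness N) (Φ : N ≃ₘ⟮𝓡 4, 𝓡 4⟯ M) :
    (B.transport Φ).seam = Φ '' B.seam := by
  have hinj : Function.Injective (Φ : N → M) := Φ.injective
  show range (Φ ∘ B.e₁) ∩ range (Φ ∘ B.e₂) = Φ '' (range B.e₁ ∩ range B.e₂)
  rw [range_comp, range_comp, image_inter hinj]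

/-- **The ∃-body of the item is a diffeomorphism invariant**: planarity is a property of the
first Stein structure alone (unchanged by transport) and the seam is moved by the (continuous)
diffeomorphism. [folklore] -/
theorem exists_planar_connected_of_diffeomorph (Φ : N ≃ₘ⟮𝓡 4, 𝓡 4⟯ M)
    (h : ∃ B : Witness N, PlanarContactBoundary B.J₁ ∧ IsConnected B.seam) :
    ∃ B : Witness M, PlanarContactBoundary B.J₁ ∧ IsConnected B.seam := by
  obtain ⟨B, hP, hC⟩ := h
  refine ⟨B.transport Φ, hP, ?_⟩
  rw [seam_transport]
  exact hC.image _ Φ.continuous.continuousOn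

end Transport

/-! ## §3 Doubles of planar Stein domains -/

/-- **Doubles of planar Stein domains satisfy the ∃-body.**  If `(W, S)` is a compact Stein
domain whose contact boundary is planar and whose boundary manifold (a boundary datum `b`) is
connected, then every double `P = W ∪_id W̄` is a Stein bisection along a common contact seam
(sibling `steinBisection_of_isDouble`, the same `S` on both halves) with planar first half and
connected seam `jA (∂W) ≅ ∂W`.  Instances on paper: `S⁴ = D(𝔻⁴)` (§4), and `S⁴ = D(C)` for every
planar Stein cork `C` (Mazur; Karakurt–Oba–Ukida, Prop. 2.3). [folklore] -/
theorem exists_planar_connected_of_isDouble {W : Type} [TopologicalSpace W]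
    [ChartedSpace (EuclideanHalfSpace 4) W] [IsManifold (𝓡∂ 4) ∞ W] [CompactSpace W]
    (b : BoundaryData (𝓡∂ 4) W (𝓡 3)) [ConnectedSpace b.carrier] (S : SteinStructure W)
    (hS : PlanarContactBoundary S) {P : Type} [TopologicalSpace P]
    [ChartedSpace (EuclideanSpace ℝ (Fin 4)) P]
    (hD : IsDouble b (𝓡 4) P) :
    ∃ B : Witness P, PlanarContactBoundary B.J₁ ∧ IsConnected B.seam := by
  obtain ⟨jA, jB, hA, hB, hU, hL, hR, hC⟩ := steinBisection_of_isDouble b S hD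
  refine ⟨⟨W, W, S, S, jA, jB, hA, hB, hU, hL, hR, hC⟩, hS, ?_⟩
  show IsConnected (range jA ∩ range jB)
  rw [hL, ← b.range_incl, ← range_comp]
  exact isConnected_range (hA.isEmbedding.continuous.comp b.continuous_incl)

/-! ## §4 The round sphere and the kill criterion (modulo the planarity of `(S³, ξ_std)`) -/

/-- The equator `S³ = ∂𝔻⁴` (the carrier of the tree's boundary datum of the closed ball) is
connected. [folklore] -/
theorem connectedSpace_closedBallBoundaryData_carrier :
    ConnectedSpace (closedBallBoundaryData 3).carrier := by
  show ConnectedSpace (Metric.sphere (0 : EuclideanSpace ℝ (Fin 4)) 1)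
  exact isConnected_iff_connectedSpace.1
    (isConnected_sphere (by
      rw [← Module.finrank_eq_rank, finrank_euclideanSpace, Fintype.card_fin]
      exact_mod_cast (by norm_num : (1 : ℕ) < 4)) (0 : (EuclideanSpace ℝ (Fin 4))) zero_le_one)

/-- **Non-vacuity at `S⁴`, modulo the planarity of the standard contact `S³`**: if the contact
boundary of the standard Stein ball `(𝔻⁴, J₀, |z|²)` is planar (it is: the disc open book — proved
in the standing disprover's work file of crux PlanarBisectionRigidity, pending as a Theorems
module), then the round `S⁴ = D(𝔻⁴)` (tree `isDouble_sphere_holds`) carries a Stein bisection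
along a common contact seam with planar first half and connected seam. [folklore] -/
theorem exists_planar_connected_sphere_of (hP : PlanarContactBoundary steinStructureClosedBall) :
    ∃ B : Witness (Metric.sphere (0 : EuclideanSpace ℝ (Fin 5)) 1),
      PlanarContactBoundary B.J₁ ∧ IsConnected B.seam :=
  haveI := connectedSpace_closedBallBoundaryData_carrier
  exists_planar_connected_of_isDouble (closedBallBoundaryData 3) steinStructureClosedBall hP
    (isDouble_sphere_holds (n := 3))

/-- **KILL CRITERION (modulo the planarity of the standard contact `S³`): the item is implied by
the summit**, `SmoothPoincare4 → PlanarBisectionExists` — transport the hemisphere bisection of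
`S⁴` along `M ≅ S⁴`. [folklore] -/
theorem planarBisectionExists_of_smoothPoincare4_of
    (hP : PlanarContactBoundary steinStructureClosedBall) (hs : _root_.SmoothPoincare4) :
    PlanarBisectionExists := by
  rw [planarBisectionExists_iff]
  intro M _ _ _ _ _ e
  obtain ⟨Φ⟩ := hs M ‹_› ‹_› e
  exact exists_planar_connected_of_diffeomorph Φ.symm (exists_planar_connected_sphere_of hP)

/-- … equivalently: **a refutation of the item is an exotic 4-sphere** (modulo the planarity of
the standard contact `S³`). [folklore] -/
theorem not_smoothPoincare4_of_not_planarBisectionExists_of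
    (hP : PlanarContactBoundary steinStructureClosedBall) (h : ¬ PlanarBisectionExists) :
    ¬ _root_.SmoothPoincare4 :=
  fun hs => h (planarBisectionExists_of_smoothPoincare4_of hP hs)

/-- The exotic sphere extracted from a refutation (modulo the planarity of the standard contact
`S³`): some smooth `M ≃ₕ S⁴` WITHOUT any planar, connected-seam Stein bisection — in particular
not diffeomorphic to `S⁴`. [folklore] -/
theorem exotic_of_not_planarBisectionExists_of
    (hP : PlanarContactBoundary steinStructureClosedBall) (h : ¬ PlanarBisectionExists) :
    ∃ (M : Type) (_ : TopologicalSpace M) (_ : T2Space M) (_ : SecondCountableTopology M)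
      (_ : ChartedSpace (EuclideanSpace ℝ (Fin 4)) M) (_ : IsManifold (𝓡 4) ∞ M),
      Nonempty (M ≃ₕ (Metric.sphere (0 : EuclideanSpace ℝ (Fin 5)) 1)) ∧
        (¬ ∃ B : Witness M, PlanarContactBoundary B.J₁ ∧ IsConnected B.seam) ∧
          IsEmpty (M ≃ₘ⟮𝓡 4, 𝓡 4⟯ (Metric.sphere (0 : EuclideanSpace ℝ (Fin 5)) 1)) := by
  rw [planarBisectionExists_iff] at h
  simp only [not_forall] at h
  obtain ⟨M, _, _, _, _, _, e, hM⟩ := h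
  refine ⟨M, ‹_›, ‹_›, ‹_›, ‹_›, ‹_›, ⟨e⟩, hM, ⟨fun Φ => hM ?_⟩⟩
  exact exists_planar_connected_of_diffeomorph Φ.symm (exists_planar_connected_sphere_of hP)

/-! ## §5 The homotopy-sphere hypothesis is load-bearing -/

/-- **Any proof must use `M ≃ₕ S⁴`** (at least its consequence `CompactSpace M`): the ∃-body of
the item fails at `M = ℝ⁴`, since every witness forces `M` to be compact
(`Witness.compactSpace`). [folklore] -/
theorem planarBisectionExists_false_without_homotopyEquiv :
    ¬ ∀ (M : Type) [TopologicalSpace M] [T2Space M] [SecondCountableTopology M]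
      [ChartedSpace (EuclideanSpace ℝ (Fin 4)) M] [IsManifold (𝓡 4) ∞ M],
      ∃ B : Witness M, PlanarContactBoundary B.J₁ ∧ IsConnected B.seam := by
  intro h
  obtain ⟨B, -, -⟩ := h (EuclideanSpace ℝ (Fin 4))
  exact (not_compactSpace_iff.2 (inferInstance : NoncompactSpace (EuclideanSpace ℝ (Fin 4))))
    B.compactSpace

/-- **The connectedness conjunct alone carries no junk-excluding force beyond nonemptiness**:
over a nonempty `M` the seam of ANY witness is nonempty (sibling `Witness.seam_nonempty`, the
`J`-convex maximum principle), so `IsConnected B.seam ↔ IsPreconnected B.seam` there. [folklore] -/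
theorem isConnected_seam_iff_isPreconnected {M : Type} [TopologicalSpace M]
    [ChartedSpace (EuclideanSpace ℝ (Fin 4)) M]
    [Nonempty M] (B : Witness M) : IsConnected B.seam ↔ IsPreconnected B.seam :=
  ⟨fun h => h.isPreconnected, fun h => ⟨B.seam_nonempty, h⟩⟩

end Summit.SmoothPoincare4.SmoothPoincare4.Theorems.PlanarBisectionExists
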